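import Literature.AnabelianGeometry.EtaleTheta.MuTwoSettingCLevel
import Literature.IUT.HodgeTheaters.LabelsPlusMinus
import HarnessLib

/-!
# [IUTchII] Rmk. 1.1.1 (iv) / [EtTh] §2: `Δ_C/Δ_X̲ ≅ 𝔽_l^{⋊±}` inside the GENUINE `Π^tp_C`, under the (R1c) clause

Mochizuki, *Inter-universal Teichmüller theory II*, §1, Remark 1.1.1 (iv), kurims manuscript (Dec. 2020) p. 23
l. 7–9: «… a certain symmetry with respect to the group `Δ_C(M^Θ)/Δ_X̲(M^Θ) ≅ 𝔽_l^{⋊±}` [cf. [IUTchI], Definition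
6.1, (v)]» [claim: Mochizuki2012, status: disputed] (IUTchII §1 Rmk 1.1.1 (iv), kurims p.23); [EtTh] §2 p. 36
(PRIMS p. 262) «`ι ∈ Δ_C` … lifts the nontrivial element of `Gal(X/C) ≅ ℤ/2ℤ` … "multiplication by `−1`"»
[cite: MochizukiEtTh2009, Def 2.1 p.36].

abc-iut cell, layer L6, NV-L6 row **FlSymmetry**, seat abc-iut-w4-d019 (gen 3), by-name row «FLSYM-GENUINE», part 1 of 2
(part 2 = `FlSymmetryGenuineTower.lean`: the two `W`-clauses of `FlSymmetry` at abc-iut-w5-d225's genuine core tower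
p437733 and the inhabitation of `FlSymmetry` there). PROOF-ONLY (0 `def` / `instance` / `structure`); dot-notation
extensions of abc-iut-L2-d3's `MuTwoSetting.CLevelData` (another directory — declared by absolute namespace per
lean/CONVENTIONS.md §2).

WHAT IS PROVED — pure group theory inside `Π^tp_C` over abc-iut-L2-t1's `MuTwoSetting` + abc-iut-L2-d3's C-level data
`e : M.CLevelData` (`inclX : Π^tp_X ↪ Π^tp_C` open normal of index 2, `augC : Π^tp_C → G_{ℚ_p}` extending `aug`, the
restricted inner automorphisms `e.conjX g : Π^tp_X ≃ₜ* Π^tp_X`, the geometric inversion of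
`exists_geometric_not_mem_range`), under ONE printed clause taken as a NAMED BINDER — the (R1c) clause of
abc-iut-L2-t10 / abc-iut-w5-d072 «the inversion `conj(ε_±)|_{Π^tp_X}` acts on `Z = Π^tp_X/Π^tp_Y` by `−1`»,
`hR1c : ∀ x, toZ (e.conjX ε_± x) = (toZ x)⁻¹` (kernel-inhabited at w5-d072's inversion model:
`SettingModel.toZ_conjX_epsPM_inversionModel`; its status at genuine data is the L2 NV ledger's, not this file's):

* `toZ_conjX_of_mem_range` / `toZ_conjX_of_not_mem_range` — conjugation by `g ∈ Π^tp_C` acts on `toZ : Π^tp_X ↠ Z`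
  by `+1` if `g ∈ Π^tp_X` (no hypothesis) and by `−1` otherwise (from `hR1c` and `[Π^tp_C : Π^tp_X] = 2`);
* `map_inclX_comap_toZ_normal` — hence `inclX(toZ⁻¹(A))` is NORMAL in `Π^tp_C` for every subgroup `A ≤ Z` (e.g.
  `Π^tp_Y = toZ⁻¹(1)`, `Π^tp_X̲ = toZ⁻¹(l·Z)`);
* `normal_and_nonempty_quotient_mulEquiv_flPM` — for `Δ_C := Ker(augC)` and `Δ_X̲ := inclX(toZ⁻¹(l·ℤ)) ∩ Δ_C`:
  `Δ_X̲ ⊴ Δ_C` and `Δ_C/Δ_X̲ ≃* 𝔽_l^{⋊±} = ℤ/l ⋊ {±1}` (abc-iut-L5's `Literature.IUT.HodgeTheaters.FlPM l`), for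
  EVERY `l : ℕ`. Proof: the extension `1 → Δ_X/Δ_X̲ ≅ ℤ/l → Δ_C/Δ_X̲ → Δ_C/Δ_X ≅ ℤ/2 → 1` is split by the class of a
  geometric inversion `ι₀ ∈ Δ_C ∖ Π^tp_X`, whose square lies in `Π^tp_Y ⊆ Π^tp_X̲` because `ι₀` both fixes and
  inverts `toZ(ι₀²)`, and `ι₀` acts on `ℤ/l` by `−1`; the isomorphism is `SemidirectProduct.lift` of
  `k ↦ [inclX(z₁)]^k` (`z₁ ∈ Δ^tp_X`, `toZ z₁ = 1`, field `toZ_delta_surjective`) and `−1 ↦ [ι₀]`, shown bijective.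

BINDER CENSUS: `e : M.CLevelData` (parameter record), `hR1c` (printed clause, [EtTh] p. 36, in the registered (R1c)
shape); no `Prop` fact introduced, no FACT-LIST row consumed. HONEST FRAMING: kernel facts about the cell's own typed
interfaces; nothing of [EtTh]/[IUTchII] is asserted; Rmk. 1.1.1 is outside the [IUTchIII] Cor. 3.12 cone; no side
taken on Cor. 3.12; typed ≠ proved; witnessed ≠ discharged.
-/

noncomputable section

/-! ## §1. Group theory inside `Π^tp_C` under the (R1c) clause -/

namespace Literature.AnabelianGeometry.EtaleTheta.MuTwoSetting.CLevelData

open Literature.AnabelianGeometry.SemiGraphs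

variable {p : ℕ} [Fact p.Prime] {M : MuTwoSetting p} (e : M.CLevelData)

/-- Inner automorphisms of `Π^tp_X` act trivially on the abelian quotient `toZ : Π^tp_X ↠ Z`.
[cite: MochizukiEtTh2009, §1 p.12] -/
theorem toZ_conjX_of_mem_range {g : M.GtpC} (hg : g ∈ M.inclX.range) (x : M.PiTemp) :
    M.toZ (e.conjX g x) = M.toZ x := by
  obtain ⟨y, rfl⟩ := hg
  rw [e.conjX_inclX, map_mul, map_mul, map_inv, mul_inv_cancel_comm]

/-- **Under (R1c)**, conjugation by ANY element of `Π^tp_C ∖ Π^tp_X` inverts `toZ` («`ι` … lifts the nontrivial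
element of `Gal(X/C) ≅ ℤ/2ℤ` … "multiplication by `−1`"», [EtTh] p. 36; `[Π^tp_C : Π^tp_X] = 2`).
[cite: MochizukiEtTh2009, Def 2.1 p.36] -/
theorem toZ_conjX_of_not_mem_range (hR1c : ∀ x : M.PiTemp, M.toZ (e.conjX M.epsPM x) = (M.toZ x)⁻¹)
    {g : M.GtpC} (hg : g ∉ M.inclX.range) (x : M.PiTemp) :
    M.toZ (e.conjX g x) = (M.toZ x)⁻¹ := by
  have hmem : M.epsPM⁻¹ * g ∈ M.inclX.range := by
    rw [Subgroup.mul_mem_iff_of_index_two M.index_range_inclX, inv_mem_iff]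
    exact ⟨fun h => absurd h M.epsPM_not_mem, fun h => absurd h hg⟩
  obtain ⟨y, hy⟩ := hmem
  have hconj : e.conjX g x = e.conjX M.epsPM (y * x * y⁻¹) := by
    apply M.injective_inclX
    rw [e.inclX_conjX, e.inclX_conjX, map_mul, map_mul, map_inv, hy]
    group
  rw [hconj, hR1c, map_mul, map_mul, map_inv, mul_inv_cancel_comm]

/-- **Under (R1c)**, `inclX(toZ⁻¹(A))` is NORMAL in `Π^tp_C` for every subgroup `A ≤ Z` (e.g. `Π^tp_Y = toZ⁻¹(1)`,
`Π^tp_X̲ = toZ⁻¹(l·Z)`): conjugation acts on `toZ` by `±1`. [cite: MochizukiEtTh2009, Def 2.5 p.39] -/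
theorem map_inclX_comap_toZ_normal (hR1c : ∀ x : M.PiTemp, M.toZ (e.conjX M.epsPM x) = (M.toZ x)⁻¹)
    (A : Subgroup (Multiplicative ℤ)) : ((A.comap M.toZ).map M.inclX).Normal := by
  refine ⟨fun n hn g => ?_⟩
  obtain ⟨x, hx, rfl⟩ := hn
  refine ⟨e.conjX g x, ?_, e.inclX_conjX g x⟩
  simp only [SetLike.mem_coe, Subgroup.mem_comap] at hx ⊢
  by_cases hg : g ∈ M.inclX.range
  · rw [e.toZ_conjX_of_mem_range hg]
    exact hx
  · rw [e.toZ_conjX_of_not_mem_range hR1c hg]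
    exact A.inv_mem hx

/-- Membership in `l·Z ≤ Z = ℤ`: `z ∈ ⟨l⟩ ↔ l ∣ z`. [cite: MochizukiEtTh2009, Def 2.5 p.39] -/
theorem mem_zpowers_ofAdd_iff (l : ℕ) (z : Multiplicative ℤ) :
    z ∈ Subgroup.zpowers (Multiplicative.ofAdd (l : ℤ)) ↔ (l : ℤ) ∣ z.toAdd := by
  rw [Subgroup.mem_zpowers_iff]
  constructor
  · rintro ⟨k, rfl⟩
    exact ⟨k, by rw [← ofAdd_zsmul, toAdd_ofAdd, smul_eq_mul, mul_comm]⟩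
  · rintro ⟨c, hc⟩
    exact ⟨c, by rw [← ofAdd_zsmul, smul_eq_mul, mul_comm, ← hc, ofAdd_toAdd]⟩

/-- **`Δ_C/Δ_X̲ ≅ 𝔽_l^{⋊±}`** ([IUTchII] Rmk. 1.1.1 (iv) «`Δ_C(M)/Δ_X̲(M) ≅ 𝔽_l^{⋊±}` [cf. [IUTchI], Def. 6.1 (v)]»,
for the genuine groups): under (R1c), for `Δ_C := Ker(augC : Π^tp_C → G_{ℚ_p})` and
`Δ_X̲ := inclX(toZ⁻¹(l·ℤ)) ∩ Δ_C`, the subgroup `Δ_X̲` is normal in `Δ_C` and `Δ_C/Δ_X̲ ≃* ℤ/l ⋊ {±1}` (for every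
`l : ℕ`). The parameter `Δ` is pinned by an equation so that consumers may feed a syntactically different kernel.
[claim: Mochizuki2012, status: disputed] (IUTchII §1 Rmk 1.1.1 (iv), kurims p.23) -/
theorem normal_and_nonempty_quotient_mulEquiv_flPM
    (hR1c : ∀ x : M.PiTemp, M.toZ (e.conjX M.epsPM x) = (M.toZ x)⁻¹) (l : ℕ) (Δ : Subgroup M.GtpC)
    (hΔ : Δ = e.augC.toMonoidHom.ker) :
    ∃ _hN : (((((Subgroup.zpowers (Multiplicative.ofAdd (l : ℤ))).comap M.toZ).map M.inclX) ⊓ Δ).subgroupOf Δ).Normal,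
      Nonempty (Δ ⧸ ((((Subgroup.zpowers (Multiplicative.ofAdd (l : ℤ))).comap M.toZ).map M.inclX) ⊓ Δ).subgroupOf Δ
        ≃* Literature.IUT.HodgeTheaters.FlPM l) := by
  classical
  subst hΔ
  set XC : Subgroup M.GtpC := ((Subgroup.zpowers (Multiplicative.ofAdd (l : ℤ))).comap M.toZ).map M.inclX
    with hXCdef
  set Δ : Subgroup M.GtpC := e.augC.toMonoidHom.ker with hΔdef
  -- ### normality
  have hXCn : XC.Normal := e.map_inclX_comap_toZ_normal hR1c _
  have hN : ((XC ⊓ Δ).subgroupOf Δ).Normal := by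
    rw [Subgroup.inf_subgroupOf_right]
    exact hXCn.subgroupOf Δ
  refine ⟨hN, ?_⟩
  haveI := hN
  set D : Subgroup Δ := (XC ⊓ Δ).subgroupOf Δ with hDdef
  -- ### membership bookkeeping
  have memΔ : ∀ g : M.GtpC, g ∈ Δ ↔ e.augC g = 1 := fun g => MonoidHom.mem_ker
  have memXC : ∀ x : M.PiTemp, M.inclX x ∈ XC ↔ (l : ℤ) ∣ (M.toZ x).toAdd := by
    intro x
    rw [← mem_zpowers_ofAdd_iff]
    constructor
    · rintro ⟨x', hx', hxx'⟩
      rw [M.injective_inclX hxx'] at hx'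
      exact hx'
    · intro hx
      exact ⟨x, hx, rfl⟩
  have XC_le_range : XC ≤ M.inclX.range := Subgroup.map_le_range _ _
  have mkD : ∀ δ : Δ, (QuotientGroup.mk δ : Δ ⧸ D) = 1 ↔ (δ : M.GtpC) ∈ XC := by
    intro δ
    rw [QuotientGroup.eq_one_iff, hDdef, Subgroup.mem_subgroupOf, Subgroup.mem_inf]
    exact ⟨fun h => h.1, fun h => ⟨h, δ.2⟩⟩
  have mkEq : ∀ δ δ' : Δ, (QuotientGroup.mk δ : Δ ⧸ D) = QuotientGroup.mk δ' ↔
      ((δ : M.GtpC)⁻¹ * δ') ∈ XC := by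
    intro δ δ'
    rw [QuotientGroup.eq, hDdef, Subgroup.mem_subgroupOf, Subgroup.mem_inf]
    exact ⟨fun h => h.1, fun h => ⟨h, (δ⁻¹ * δ').2⟩⟩
  -- ### the generator `z₁ ∈ Δ^tp_X` with `toZ z₁ = 1`, and its class `q`
  obtain ⟨⟨z₁, hz₁Δ⟩, hz₁⟩ := M.toZ_delta_surjective (Multiplicative.ofAdd 1)
  rw [MonoidHom.restrict_apply] at hz₁
  change M.toZ z₁ = Multiplicative.ofAdd 1 at hz₁
  have haug_z₁ : M.aug z₁ = 1 := hz₁Δ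
  have ha_mem : M.inclX z₁ ∈ Δ := by rw [memΔ, e.augC_inclX, haug_z₁]
  set a : Δ := ⟨M.inclX z₁, ha_mem⟩ with hadef
  set q : Δ ⧸ D := QuotientGroup.mk a with hqdef
  have toZ_zpow : ∀ k : ℤ, M.toZ (z₁ ^ k) = Multiplicative.ofAdd k := by
    intro k
    rw [map_zpow, hz₁, ← ofAdd_zsmul, smul_eq_mul, mul_one]
  have coe_a_zpow : ∀ k : ℤ, ((a ^ k : Δ) : M.GtpC) = M.inclX (z₁ ^ k) := by
    intro k
    rw [SubgroupClass.coe_zpow, map_zpow]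
  -- `q ^ k = [inclX x]` whenever `toZ x = k` (for `x ∈ Δ^tp_X`)
  have q_zpow_eq : ∀ (x : M.PiTemp) (hx : M.inclX x ∈ Δ),
      q ^ (M.toZ x).toAdd = QuotientGroup.mk (⟨M.inclX x, hx⟩ : Δ) := by
    intro x hx
    rw [hqdef, ← QuotientGroup.mk_zpow, mkEq, coe_a_zpow, ← map_inv, ← map_mul, memXC, map_mul, map_inv,
      toZ_zpow]
    simp
  have q_pow_l : q ^ (l : ℤ) = 1 := by
    rw [hqdef, ← QuotientGroup.mk_zpow, mkD, coe_a_zpow, memXC, toZ_zpow, toAdd_ofAdd]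
  -- ### the inversion class `j`
  obtain ⟨ι₀, hι₀N, hι₀⟩ := e.exists_geometric_not_mem_range
  have hι₀Δ : ι₀ ∈ Δ := by rw [memΔ]; exact hι₀
  set i₀ : Δ := ⟨ι₀, hι₀Δ⟩ with hi₀def
  set j : Δ ⧸ D := QuotientGroup.mk i₀ with hjdef
  -- every element outside `Π^tp_X` is `ι₀ · inclX(y)`
  have decomp : ∀ g : M.GtpC, g ∉ M.inclX.range → ∃ y : M.PiTemp, g = ι₀ * M.inclX y := by
    intro g hg
    have hmem : ι₀⁻¹ * g ∈ M.inclX.range := by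
      rw [Subgroup.mul_mem_iff_of_index_two M.index_range_inclX, inv_mem_iff]
      exact ⟨fun h => absurd h hι₀N, fun h => absurd h hg⟩
    obtain ⟨y, hy⟩ := hmem
    exact ⟨y, by rw [hy, mul_inv_cancel_left]⟩
  -- `ι₀² ∈ Π^tp_Y ⊆ XC`
  have hι₀sq : ι₀ * ι₀ ∈ XC := by
    have hmem : ι₀ * ι₀ ∈ M.inclX.range := by
      rw [Subgroup.mul_mem_iff_of_index_two M.index_range_inclX]
    obtain ⟨w, hw⟩ := hmem
    have hfix : e.conjX ι₀ w = w := by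
      apply M.injective_inclX
      rw [e.inclX_conjX, hw]
      group
    have hinv : M.toZ w = (M.toZ w)⁻¹ := by
      conv_lhs => rw [← hfix]
      exact e.toZ_conjX_of_not_mem_range hR1c hι₀N w
    have h0 : (M.toZ w).toAdd = 0 := by
      have h2 : (M.toZ w).toAdd = -(M.toZ w).toAdd := congrArg Multiplicative.toAdd hinv
      omega
    rw [← hw, memXC, h0]
    exact dvd_zero _
  have hjj : j * j = 1 := by
    rw [hjdef, ← QuotientGroup.mk_mul, mkD]
    exact hι₀sq
  -- `j q j⁻¹ = q⁻¹`
  have hjq : j * q * j⁻¹ = q⁻¹ := by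
    rw [← mul_inv_eq_one, inv_inv, hjdef, hqdef, ← QuotientGroup.mk_mul, ← QuotientGroup.mk_inv,
      ← QuotientGroup.mk_mul, ← QuotientGroup.mk_mul, mkD]
    change ι₀ * M.inclX z₁ * ι₀⁻¹ * M.inclX z₁ ∈ XC
    rw [← e.inclX_conjX, ← map_mul, memXC, map_mul, e.toZ_conjX_of_not_mem_range hR1c hι₀N, inv_mul_cancel]
    exact dvd_zero _
  -- ### the homomorphism `𝔽_l^{⋊±} → Δ_C/Δ_X̲`
  set ψ : ℤ →+ Additive (Δ ⧸ D) := zmultiplesHom (Additive (Δ ⧸ D)) (Additive.ofMul q) with hψdef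
  have hψ : ψ (l : ℤ) = 0 := by
    rw [hψdef, zmultiplesHom_apply, ← ofMul_zpow, q_pow_l, ofMul_one]
  set f₁ : Multiplicative (ZMod l) →* (Δ ⧸ D) :=
    AddMonoidHom.toMultiplicativeLeft (ZMod.lift l ⟨ψ, hψ⟩) with hf₁def
  have f₁_coe : ∀ k : ℤ, f₁ (Multiplicative.ofAdd ((k : ℤ) : ZMod l)) = q ^ k := by
    intro k
    rw [hf₁def, AddMonoidHom.coe_toMultiplicativeLeft, Function.comp_apply, Function.comp_apply, toAdd_ofAdd,
      ZMod.lift_coe]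
    change Additive.toMul (ψ k) = q ^ k
    rw [hψdef, zmultiplesHom_apply, ← ofMul_zpow, toMul_ofMul]
  have hm1 : (-1 : ℤˣ) ≠ 1 := by decide
  set f₂ : ℤˣ →* (Δ ⧸ D) :=
    { toFun := fun u => if u = 1 then 1 else j
      map_one' := if_pos rfl
      map_mul' := by
        intro u v
        rcases Int.units_eq_one_or u with rfl | rfl <;> rcases Int.units_eq_one_or v with rfl | rfl
        · simp
        · simp [hm1]
        · simp [hm1]
        · rw [Int.units_mul_self, if_pos rfl, if_neg hm1, hjj] } with hf₂def
  have f₂_neg : f₂ (-1) = j := by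
    rw [hf₂def, MonoidHom.coe_mk, OneHom.coe_mk]
    exact if_neg hm1
  have hcompat : ∀ u : ℤˣ, f₁.comp (Literature.IUT.HodgeTheaters.signAct l u).toMonoidHom =
      (MulAut.conj (f₂ u)).toMonoidHom.comp f₁ := by
    intro u
    rcases Int.units_eq_one_or u with rfl | rfl
    · refine MonoidHom.ext fun n => ?_
      simp
    · rw [f₂_neg]
      refine MonoidHom.ext fun n => ?_
      obtain ⟨k, hk⟩ := ZMod.intCast_surjective n.toAdd
      have hn : n = Multiplicative.ofAdd ((k : ℤ) : ZMod l) := by rw [hk, ofAdd_toAdd]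
      rw [MonoidHom.comp_apply, MonoidHom.comp_apply, MulEquiv.coe_toMonoidHom, MulEquiv.coe_toMonoidHom,
        Literature.IUT.HodgeTheaters.signAct_apply, MulAut.conj_apply, hn, toAdd_ofAdd, Units.smul_def,
        Units.val_neg, Units.val_one, neg_one_zsmul, ← Int.cast_neg, f₁_coe, f₁_coe, zpow_neg,
        ← MulAut.conj_apply, map_zpow, MulAut.conj_apply, hjq, inv_zpow]
  set Ψ : Literature.IUT.HodgeTheaters.FlPM l →* (Δ ⧸ D) := SemidirectProduct.lift f₁ f₂ hcompat with hΨdef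
  -- ### bijectivity
  have Ψ_mk : ∀ (n : Multiplicative (ZMod l)) (u : ℤˣ),
      Ψ ⟨n, u⟩ = f₁ n * f₂ u := by
    intro n u
    rw [SemidirectProduct.mk_eq_inl_mul_inr, map_mul, hΨdef, SemidirectProduct.lift_inl,
      SemidirectProduct.lift_inr]
  have hsurj : Function.Surjective Ψ := by
    intro y
    obtain ⟨δ, rfl⟩ := QuotientGroup.mk_surjective y
    by_cases hδ : (δ : M.GtpC) ∈ M.inclX.range
    · obtain ⟨x, hx⟩ := hδ
      have hxΔ : M.inclX x ∈ Δ := by rw [hx]; exact δ.2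
      refine ⟨⟨Multiplicative.ofAdd (((M.toZ x).toAdd : ℤ) : ZMod l), 1⟩, ?_⟩
      rw [Ψ_mk, map_one, mul_one, f₁_coe, q_zpow_eq x hxΔ]
      congr 1
      exact Subtype.ext hx
    · obtain ⟨x, hx⟩ := decomp δ hδ
      have hxΔ : M.inclX x ∈ Δ := by
        have h := δ.2
        rw [hx] at h
        exact (Δ.mul_mem_cancel_left hι₀Δ).1 h
      refine ⟨⟨Multiplicative.ofAdd ((-(M.toZ x).toAdd : ℤ) : ZMod l), -1⟩, ?_⟩
      -- Ψ ⟨n, -1⟩ = f₁ n * j, and [δ] = [ι₀ · inclX x] = j * [inclX x] = j * q^k = q^{-k} * j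
      rw [Ψ_mk, f₂_neg, f₁_coe, zpow_neg]
      have hδ' : (QuotientGroup.mk δ : Δ ⧸ D) = j * QuotientGroup.mk (⟨M.inclX x, hxΔ⟩ : Δ) := by
        rw [hjdef, ← QuotientGroup.mk_mul]
        congr 1
        exact Subtype.ext hx
      rw [hδ', ← q_zpow_eq x hxΔ]
      -- q^{-k} * j = j * q^k  ⟸  j q^k j⁻¹ = q^{-k}
      have hconjk : j * q ^ (M.toZ x).toAdd * j⁻¹ = (q ^ (M.toZ x).toAdd)⁻¹ := by
        rw [← MulAut.conj_apply, map_zpow, MulAut.conj_apply, hjq, inv_zpow]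
      rw [← hconjk, inv_mul_cancel_right]
  have hinj : Function.Injective Ψ := by
    rw [injective_iff_map_eq_one]
    rintro ⟨n, u⟩ h
    rw [Ψ_mk] at h
    obtain ⟨k, hk⟩ := ZMod.intCast_surjective n.toAdd
    have hn : n = Multiplicative.ofAdd ((k : ℤ) : ZMod l) := by rw [hk, ofAdd_toAdd]
    rw [hn, f₁_coe] at h
    rcases Int.units_eq_one_or u with rfl | rfl
    · -- `q ^ k = 1` forces `l ∣ k`
      rw [map_one, mul_one, hqdef, ← QuotientGroup.mk_zpow, mkD, coe_a_zpow, memXC, toZ_zpow,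
        toAdd_ofAdd, ← CharP.intCast_eq_zero_iff (ZMod l) l] at h
      rw [hn, h]
      rfl
    · -- `q ^ k * j = 1` would put `ι₀` in `Π^tp_X`
      exfalso
      rw [f₂_neg, hjdef, hqdef, ← QuotientGroup.mk_zpow, ← QuotientGroup.mk_mul, mkD] at h
      have h' : ((a ^ k * i₀ : Δ) : M.GtpC) ∈ M.inclX.range := XC_le_range h
      rw [Subgroup.coe_mul, coe_a_zpow] at h'
      exact hι₀N ((M.inclX.range.mul_mem_cancel_left ⟨z₁ ^ k, rfl⟩).1 h')
  exact ⟨(MulEquiv.ofBijective Ψ ⟨hinj, hsurj⟩).symm⟩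

end Literature.AnabelianGeometry.EtaleTheta.MuTwoSetting.CLevelData

end
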